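import Literature.Analysis.FluidPDE.BoundedAnnihilator
import Literature.Analysis.FluidPDE.AncientMildPairing
import HarnessLib

/-!
# Directional invariance of bounded solenoidal fields from vanishing directional pairings

Analysis/FluidPDE support file (all results proved; no definitions, no named facts) for the
gauge bridge between the tree's duality-form class of bounded ancient mild solutions
(`IsBoundedAncientMildSolution`: slices known only through their pairings with divergence-free
test fields) and the bounded ancient solutions of Koch–Nadirashvili–Seregin–Šverák, Acta Math.
203 (2009) = arXiv:0709.3599. In the duality-form class the "parasitic" spatially constant
drift `b(t)` of KNSS 2009, §1, p. 3 (the solutions `u(x, t) = b(t)` and, more generally, the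
Galilean images of honest solutions) is invisible exactly in the directions along which a slice
is translation invariant, and the gauge-fixing theorem of the Liouville programme (crux
`TypeIliouvilleL`, the conjecture (L) of KNSS 2009) has to recognise those directions from the
pairings alone. This file supplies that step:

* `Literature.Analysis.FluidPDE.ae_invariant_of_forall_integral_inner_fderiv_apply_eq_zero` —
  a bounded, a.e. strongly measurable, weakly divergence-free field `w : E → E` on a
  finite-dimensional real inner product space with `∫ ⟪w, ∂ₑφ⟫ = 0` for every divergence-free
  test field `φ ∈ C_c^∞(E; E)` satisfies `w(· + s e) = w` a.e., for every `s : ℝ`.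

## Proof

For a divergence-free test field `φ` the translates `φ(· - r e)` are again divergence-free
test fields, so `r ↦ ∫ ⟪w, φ(· - r e)⟫` has derivative `-∫ ⟪w, ∂ₑ[φ(· - r e)]⟫ = 0`
(differentiation under the integral sign, `hasDerivAt_integral_of_dominated_loc_of_deriv_le`:
for `|r - r₀| < 1` the integrands `⟪w, Dφ(· - r e)(-e)⟫` are dominated by `M ‖Dφ‖_∞ ‖e‖` times
the indicator of a fixed closed ball) and is constant (`is_const_of_deriv_eq_zero`). Changing
variables, the bounded weakly divergence-free field `d_s = w(· + s e) - w` annihilates every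
divergence-free test field, hence is a.e. equal to a constant `κ` by the `L^∞` annihilator
lemma `IsWeaklyDivFree.exists_ae_eq_const_of_norm_le_of_forall_integral_inner_eq_zero`
(KNSS 2009, Lemma 3.1, p. 7); iterating the a.e. identity `w(· + s e) - w = κ` along the
measure-preserving translation gives `w(· + n s e) - w = n κ` a.e. with `‖n κ‖ ≤ 2M` for all
`n`, so `κ = 0`.

The same statement is reached, through the `L¹` convergence of difference quotients and behind
the imports of the KNSS Theorem 5.2 bridge, by
`Literature.Analysis.FluidPDE.ae_eq_comp_add_smul_of_forall_integral_inner_fderiv_eq_zero`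
(`KNSSThm52SliceBridge`); the present file places the fact at the level of the annihilator
lemma (imports `BoundedAnnihilator` and `AncientMildPairing` only), in the form
`(fun x => w (x + s • e)) =ᵐ[volume] w` consumed by
`integral_inner_fderiv_heatTest_apply_eq_zero_of_ae_invariant` (`AncientMildDrift`). What is
NOT here: anything about the time variable (the gauge-fixing construction itself).

## References

* G. Koch, N. Nadirashvili, G. Seregin, V. Šverák, *Liouville theorems for the Navier–Stokes
  equations and applications*, Acta Math. 203 (2009), 83–105 = arXiv:0709.3599, §1 p. 3 (the
  parasitic solutions `b(t)` and the Galilean gauge) and Lemma 3.1 p. 7 (bounded fields with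
  `curl z = 0`, `div z = 0` are constant). [KochNadirashviliSereginSverak2009]
-/

noncomputable section

open MeasureTheory Set Function Filter Topology TopologicalSpace InnerProductSpace Metric
open scoped RealInnerProductSpace

namespace Literature.Analysis.FluidPDE

variable {E : Type*} [NormedAddCommGroup E] [InnerProductSpace ℝ E] [FiniteDimensional ℝ E]
  [MeasurableSpace E] [BorelSpace E]

/-! ### Translates of test fields and of weakly divergence-free fields -/

section Translate

omit [FiniteDimensional ℝ E] [MeasurableSpace E] [BorelSpace E] in
/-- A translate `φ(· - a)` of a test field on the whole space is a test field on the whole space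
(Evans, *PDE*, §5.2.1: `C_c^∞` is translation invariant). [folklore] -/
private theorem isTestFunctionOn_top_comp_sub_right {F : Type*} [NormedAddCommGroup F]
    [NormedSpace ℝ F] {φ : E → F} (hφ : FunctionSpaces.IsTestFunctionOn (⊤ : Opens E) φ)
    (a : E) : FunctionSpaces.IsTestFunctionOn (⊤ : Opens E) fun x => φ (x - a) where
  -- adapted from `isTestFunctionOn_top_comp_sub` (`KNSSRegularityGalileanProofs`)
  contDiff := hφ.contDiff.comp (contDiff_id.sub contDiff_const)
  hasCompactSupport := by
    simpa [sub_eq_add_neg, Function.comp_def] using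
      hφ.hasCompactSupport.comp_homeomorph (Homeomorph.addRight (-a))
  tsupport_subset := by simp

omit [FiniteDimensional ℝ E] [MeasurableSpace E] [BorelSpace E] in
/-- A translate `φ(· - a)` of a divergence-free field is divergence free: the divergence is
translation covariant, `div (φ(· - a)) (x) = div φ (x - a)` (chain rule with a translation).
[folklore] -/
private theorem isDivFree_comp_sub_right {φ : E → E} (hφ : VectorCalculus.IsDivFree φ)
    (a : E) : VectorCalculus.IsDivFree fun x => φ (x - a) := by
  -- adapted from `divergence_comp_sub_right` (`KNSSRegularityGalilean`)
  intro x
  have h := hφ (x - a)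
  simp only [VectorCalculus.divergence] at h ⊢
  rwa [fderiv_comp_sub]

/-- **Weak divergence-freeness is translation invariant**: `u(· + c)` is weakly divergence free
when `u` is (test the defining identity `∫ ⟪u, ∇θ⟫ = 0` against `θ(· - c)` and change
variables in the Lebesgue integral). [folklore] -/
private theorem isWeaklyDivFree_comp_add_right {u : E → E} (hu : IsWeaklyDivFree u) (c : E) :
    IsWeaklyDivFree fun x => u (x + c) := by
  -- adapted from `IsWeaklyDivFree.comp_add_right'` (`KNSSRegularityGalileanProofs`)
  intro θ hθ
  have key := hu (fun y => θ (y - c)) (isTestFunctionOn_top_comp_sub_right hθ c)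
  have hg : ∀ y, gradient (fun y => θ (y - c)) y = gradient θ (y - c) := fun y => by
    simp only [gradient, fderiv_comp_sub]
  simp_rw [hg] at key
  rw [← integral_add_right_eq_self (fun y => ⟪u y, gradient θ (y - c)⟫) c] at key
  simpa using key

end Translate

/-! ### Pairings with translates along `e` are constant -/

section Pairing

/-- **Pairings with the translates along `e` are constant when the `e`-derivatives of all
divergence-free test fields are annihilated.** If `v` is bounded and a.e. strongly measurable
with `∫ ⟪v, ∂ₑφ⟫ = 0` for every divergence-free test field `φ`, then
`∫ ⟪v, φ(· - s e)⟫ = ∫ ⟪v, φ⟫` for every such `φ` and every `s : ℝ`: the function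
`r ↦ ∫ ⟪v, φ(· - r e)⟫` is differentiated under the integral sign
(`hasDerivAt_integral_of_dominated_loc_of_deriv_le`; for `|r - r₀| < 1` the integrands
`⟪v, Dφ(· - r e)(-e)⟫` are dominated by `M ‖Dφ‖_∞ ‖e‖` on a fixed closed ball and vanish
off it), and its derivative `∫ ⟪v, Dφ(· - r₀ e)(-e)⟫ = -∫ ⟪v, ∂ₑ[φ(· - r₀ e)]⟫` vanishes by
hypothesis, the translate being a divergence-free test field. [folklore] -/
private theorem integral_inner_comp_sub_smul_eq {v : E → E} (hv : AEStronglyMeasurable v volume)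
    {M : ℝ} (hM : ∀ x, ‖v x‖ ≤ M) {e : E}
    (h0 : ∀ φ : E → E, FunctionSpaces.IsTestFunctionOn (⊤ : Opens E) φ →
      VectorCalculus.IsDivFree φ → ∫ x, ⟪v x, fderiv ℝ φ x e⟫ = 0)
    {φ : E → E} (hφ : FunctionSpaces.IsTestFunctionOn (⊤ : Opens E) φ)
    (hdiv : VectorCalculus.IsDivFree φ) (s : ℝ) :
    ∫ x, ⟪v x, φ (x - s • e)⟫ = ∫ x, ⟪v x, φ x⟫ := by
  have hM0 : 0 ≤ M := (norm_nonneg _).trans (hM 0)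
  have hφ1 : ContDiff ℝ 1 φ := hφ.contDiff.of_le (by exact_mod_cast le_top)
  have hφc : Continuous φ := hφ.contDiff.continuous
  have hDc : Continuous (fderiv ℝ φ) := hφ1.continuous_fderiv one_ne_zero
  have hφi : Integrable φ := hφc.integrable_of_hasCompactSupport hφ.hasCompactSupport
  obtain ⟨C, hC⟩ := (hφ.hasCompactSupport.fderiv ℝ).exists_bound_of_continuous hDc
  obtain ⟨R, hR⟩ := hφ.hasCompactSupport.isCompact.isBounded.subset_closedBall (0 : E)
  -- `Dφ` vanishes off the closed ball of radius `R`
  have hDz : ∀ y : E, R < ‖y‖ → fderiv ℝ φ y = 0 := fun y hy =>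
    image_eq_zero_of_notMem_tsupport fun h' => by
      have h'' := hR (tsupport_fderiv_subset ℝ h')
      rw [mem_closedBall_zero_iff] at h''
      exact absurd h'' (not_le.2 hy)
  set F : ℝ → ℝ := fun r => ∫ x, ⟪v x, φ (x - r • e)⟫ with hF
  -- `F` has derivative zero everywhere
  have hderiv : ∀ r₀ : ℝ, HasDerivAt F 0 r₀ := by
    intro r₀
    set K : Set E := closedBall (0 : E) (|R| + (|r₀| + 1) * ‖e‖) with hK
    have hKi : Integrable (K.indicator fun _ => M * (C * ‖e‖)) volume :=
      (integrable_indicator_iff isClosed_closedBall.measurableSet).2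
        (integrableOn_const ((isCompact_closedBall _ _).measure_lt_top).ne)
    have hmeas : ∀ᶠ r in 𝓝 r₀,
        AEStronglyMeasurable (fun x => ⟪v x, φ (x - r • e)⟫) (volume : Measure E) :=
      Eventually.of_forall fun r =>
        hv.inner (hφc.comp (continuous_id.sub continuous_const)).aestronglyMeasurable
    have hint : Integrable (fun x => ⟪v x, φ (x - r₀ • e)⟫) (volume : Measure E) :=
      integrable_inner_of_aestronglyMeasurable_of_norm_le hv hM (hφi.comp_sub_right (r₀ • e))
    have hmeas' : AEStronglyMeasurable (fun x => ⟪v x, fderiv ℝ φ (x - r₀ • e) (-e)⟫)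
        (volume : Measure E) :=
      hv.inner ((hDc.comp (continuous_id.sub continuous_const)).clm_apply
        continuous_const).aestronglyMeasurable
    -- domination on `|r - r₀| < 1`
    have hbound : ∀ᵐ x ∂(volume : Measure E), ∀ r ∈ ball r₀ 1,
        ‖⟪v x, fderiv ℝ φ (x - r • e) (-e)⟫‖ ≤ K.indicator (fun _ => M * (C * ‖e‖)) x := by
      refine Eventually.of_forall fun x r hr => ?_
      by_cases hx : x ∈ K
      · rw [indicator_of_mem hx]
        calc ‖⟪v x, fderiv ℝ φ (x - r • e) (-e)⟫‖
            ≤ ‖v x‖ * ‖fderiv ℝ φ (x - r • e) (-e)‖ := norm_inner_le_norm _ _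
          _ ≤ M * (C * ‖e‖) := by
            refine mul_le_mul (hM x) ?_ (norm_nonneg _) hM0
            calc ‖fderiv ℝ φ (x - r • e) (-e)‖ ≤ ‖fderiv ℝ φ (x - r • e)‖ * ‖-e‖ :=
                  ContinuousLinearMap.le_opNorm _ _
              _ ≤ C * ‖e‖ := by
                rw [norm_neg]
                exact mul_le_mul_of_nonneg_right (hC _) (norm_nonneg _)
      · rw [indicator_of_notMem hx]
        have hr' : |r| < |r₀| + 1 := by
          have h1 : |r - r₀| < 1 := by simpa [Real.dist_eq] using hr
          calc |r| = |(r - r₀) + r₀| := by rw [sub_add_cancel]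
            _ ≤ |r - r₀| + |r₀| := abs_add_le _ _
            _ < |r₀| + 1 := by linarith
        have hxK : |R| + (|r₀| + 1) * ‖e‖ < ‖x‖ := by
          rw [hK, mem_closedBall_zero_iff, not_le] at hx
          exact hx
        have hy : R < ‖x - r • e‖ := by
          have h1 : ‖x‖ - ‖r • e‖ ≤ ‖x - r • e‖ := norm_sub_norm_le _ _
          have h2 : ‖r • e‖ ≤ (|r₀| + 1) * ‖e‖ := by
            rw [norm_smul, Real.norm_eq_abs]
            exact mul_le_mul_of_nonneg_right hr'.le (norm_nonneg _)
          linarith [le_abs_self R]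
        rw [hDz _ hy]
        simp
    -- pointwise derivatives (chain rule along `r ↦ x - r e`)
    have hdiff : ∀ᵐ x ∂(volume : Measure E), ∀ r ∈ ball r₀ 1,
        HasDerivAt (fun r : ℝ => ⟪v x, φ (x - r • e)⟫) ⟪v x, fderiv ℝ φ (x - r • e) (-e)⟫ r := by
      refine Eventually.of_forall fun x r _ => ?_
      have hp : HasDerivAt (fun r : ℝ => x - r • e) (-e) r := by
        simpa using ((hasDerivAt_id r).smul_const e).const_sub x
      have hd : HasDerivAt (fun r : ℝ => φ (x - r • e)) (fderiv ℝ φ (x - r • e) (-e)) r :=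
        ((hφ1.differentiable one_ne_zero) (x - r • e)).hasFDerivAt.comp_hasDerivAt r hp
      have hi := (hasDerivAt_const r (v x)).inner ℝ hd
      rwa [inner_zero_left, add_zero] at hi
    have key := (hasDerivAt_integral_of_dominated_loc_of_deriv_le
      (F := fun r x => ⟪v x, φ (x - r • e)⟫)
      (F' := fun r x => ⟪v x, fderiv ℝ φ (x - r • e) (-e)⟫)
      (ball_mem_nhds r₀ one_pos) hmeas hint hmeas' hbound hKi hdiff).2
    -- the derivative at `r₀` vanishes: the translate is a divergence-free test field
    have hzero : ∫ x, ⟪v x, fderiv ℝ φ (x - r₀ • e) (-e)⟫ = 0 := by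
      have h1 := h0 (fun y => φ (y - r₀ • e)) (isTestFunctionOn_top_comp_sub_right hφ _)
        (isDivFree_comp_sub_right hdiv _)
      simp_rw [fderiv_comp_sub] at h1
      simp_rw [map_neg, inner_neg_right, integral_neg, h1, neg_zero]
    rw [hzero] at key
    exact key
  have hconst := is_const_of_deriv_eq_zero (fun r => (hderiv r).differentiableAt)
    (fun r => (hderiv r).deriv) s 0
  simpa [hF] using hconst

end Pairing

/-! ### A.e.-constant increments of a bounded field vanish -/

section Increment

/-- **Iterated a.e.-constant increments are unbounded unless zero**: if `v(· + b) - v = κ`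
a.e. for a bounded `v` (`‖v‖ ≤ M`), then `κ = 0`: translating the a.e. identity by the
measure-preserving `x ↦ x + b` and adding gives `v(· + n b) - v = n κ` a.e. by induction, while
`‖n κ‖ ≤ 2M` at any point where the identity holds. [folklore] -/
private theorem eq_zero_of_ae_comp_add_sub_eq_const_of_norm_le {v : E → E} {M : ℝ}
    (hM : ∀ x, ‖v x‖ ≤ M) {b κ : E} (h : (fun x => v (x + b) - v x) =ᵐ[volume] fun _ => κ) :
    κ = 0 := by
  -- adapted from `eq_zero_of_ae_comp_add_sub_eq_const` (`KNSSThm52SliceBridge`)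
  -- `v(x + n b) - v x = n κ` a.e.
  have hiter : ∀ n : ℕ,
      (fun x => v (x + (n : ℝ) • b) - v x) =ᵐ[volume] fun _ => (n : ℝ) • κ := by
    intro n
    induction n with
    | zero => exact Eventually.of_forall fun x => by simp
    | succ n ih =>
      have ih' : (fun x => v (x + b + (n : ℝ) • b) - v (x + b)) =ᵐ[volume]
          fun _ => (n : ℝ) • κ :=
        (measurePreserving_add_right volume b).quasiMeasurePreserving.ae_eq ih
      filter_upwards [ih', h] with x hx hx'
      have e1 : x + ((n : ℝ) + 1) • b = x + b + (n : ℝ) • b := by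
        rw [add_smul, one_smul]; abel
      simp only [Nat.cast_succ, e1]
      calc v (x + b + (n : ℝ) • b) - v x
          = (v (x + b + (n : ℝ) • b) - v (x + b)) + (v (x + b) - v x) := by abel
        _ = (n : ℝ) • κ + κ := by rw [hx, hx']
        _ = ((n : ℝ) + 1) • κ := by rw [add_smul, one_smul]
  -- `‖n κ‖ ≤ 2M` for all `n`
  have hbd : ∀ n : ℕ, (n : ℝ) * ‖κ‖ ≤ 2 * M := by
    intro n
    obtain ⟨x, hx⟩ := (hiter n).exists
    have hx' : v (x + (n : ℝ) • b) - v x = (n : ℝ) • κ := hx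
    have h2 : ‖(n : ℝ) • κ‖ ≤ 2 * M := by
      rw [← hx']
      exact (norm_sub_le _ _).trans (by linarith [hM (x + (n : ℝ) • b), hM x])
    rwa [norm_smul, Real.norm_of_nonneg (Nat.cast_nonneg n)] at h2
  by_contra hκ
  have hκ' : 0 < ‖κ‖ := norm_pos_iff.2 hκ
  obtain ⟨n, hn⟩ := exists_nat_gt (2 * M / ‖κ‖)
  have h3 := hbd n
  rw [div_lt_iff₀ hκ'] at hn
  linarith

end Increment

/-! ### Directional invariance -/

section Invariance

/-- **A bounded weakly divergence-free field all of whose pairings with `e`-derivatives of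
divergence-free test fields vanish is invariant under the translations along `e`.** Let `E`
be a finite-dimensional real inner product space with its Lebesgue measure, `w : E → E` a.e.
strongly measurable, bounded (`‖w‖ ≤ M`) and weakly divergence free, and suppose
`∫ ⟪w, Dφ(·) e⟫ = 0` for every test field `φ ∈ C_c^∞(E; E)` with `div φ = 0`. Then
`w(· + s e) = w` a.e. for every `s : ℝ`. For each `s` the field `w(· + s e) - w` is bounded,
a.e. strongly measurable, weakly divergence free (translation covariance) and annihilates the
divergence-free test fields (change of variables and `integral_inner_comp_sub_smul_eq`: the
pairings with the translates `φ(· - s e)` do not depend on `s`), hence is a.e. a constant by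
the `L^∞` annihilator lemma
`IsWeaklyDivFree.exists_ae_eq_const_of_norm_le_of_forall_integral_inner_eq_zero` (KNSS 2009,
Lemma 3.1), and that constant vanishes (`eq_zero_of_ae_comp_add_sub_eq_const_of_norm_le`).
This is the step of the gauge bridge for the duality-form Liouville conjecture (KNSS 2009, §1
p. 3) that identifies the directions in which the parasitic drift is invisible. [folklore] -/
theorem ae_invariant_of_forall_integral_inner_fderiv_apply_eq_zero {w : E → E}
    (hw : AEStronglyMeasurable w volume) {M : ℝ} (hM : ∀ x, ‖w x‖ ≤ M) (hdiv : IsWeaklyDivFree w)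
    {e : E}
    (h : ∀ φ : E → E, FunctionSpaces.IsTestFunctionOn (⊤ : Opens E) φ → VectorCalculus.IsDivFree φ →
      ∫ x, ⟪w x, fderiv ℝ φ x e⟫ = 0) :
    ∀ s : ℝ, (fun x => w (x + s • e)) =ᵐ[volume] w := by
  -- adapted from `ae_eq_comp_add_smul_of_forall_integral_inner_fderiv_eq_zero`
  -- (`KNSSThm52SliceBridge`)
  intro s
  set g : E → E := fun x => w (x + s • e) - w x with hg
  have hwt : AEStronglyMeasurable (fun x => w (x + s • e)) volume :=
    hw.comp_quasiMeasurePreserving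
      (measurePreserving_add_right volume (s • e)).quasiMeasurePreserving
  have hgm : AEStronglyMeasurable g volume := hwt.sub hw
  have hgb : ∀ x, ‖g x‖ ≤ M + M := fun x => (norm_sub_le _ _).trans (add_le_add (hM _) (hM _))
  -- `g` is weakly divergence free
  have hgdiv : IsWeaklyDivFree g := by
    intro θ hθ
    have hgi : Integrable (gradient θ) := by
      haveI : CompleteSpace E := FiniteDimensional.complete ℝ E
      have hθ1 : ContDiff ℝ 1 θ := hθ.contDiff.of_le (by exact_mod_cast le_top)
      exact ((InnerProductSpace.toDual ℝ E).symm.continuous.comp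
        (hθ1.continuous_fderiv one_ne_zero)).integrable_of_hasCompactSupport
          ((hθ.hasCompactSupport.fderiv ℝ).comp_left
            (g := fun L => (InnerProductSpace.toDual ℝ E).symm L) (map_zero _))
    have i1 : Integrable fun x => ⟪w (x + s • e), gradient θ x⟫ :=
      integrable_inner_of_aestronglyMeasurable_of_norm_le hwt (fun x => hM _) hgi
    have i2 : Integrable fun x => ⟪w x, gradient θ x⟫ :=
      integrable_inner_of_aestronglyMeasurable_of_norm_le hw hM hgi
    show ∫ x, ⟪w (x + s • e) - w x, gradient θ x⟫ = 0
    simp_rw [inner_sub_left]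
    rw [integral_sub i1 i2, (isWeaklyDivFree_comp_add_right hdiv (s • e)) θ hθ, hdiv θ hθ,
      sub_zero]
  -- `g` annihilates the divergence-free test fields
  have horth : ∀ φ : E → E, FunctionSpaces.IsTestFunctionOn (⊤ : Opens E) φ →
      VectorCalculus.IsDivFree φ → ∫ x, ⟪g x, φ x⟫ = 0 := by
    intro φ hφ hdivφ
    have hφi : Integrable φ :=
      hφ.contDiff.continuous.integrable_of_hasCompactSupport hφ.hasCompactSupport
    have i1 : Integrable fun x => ⟪w (x + s • e), φ x⟫ :=
      integrable_inner_of_aestronglyMeasurable_of_norm_le hwt (fun x => hM _) hφi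
    have i2 : Integrable fun x => ⟪w x, φ x⟫ :=
      integrable_inner_of_aestronglyMeasurable_of_norm_le hw hM hφi
    -- `∫ ⟪w(x + s e), φ x⟫ = ∫ ⟪w x, φ(x - s e)⟫`
    have hshift : ∫ x, ⟪w (x + s • e), φ x⟫ = ∫ x, ⟪w x, φ (x - s • e)⟫ := by
      have h1 := integral_add_right_eq_self (μ := (volume : Measure E))
        (fun x => ⟪w x, φ (x - s • e)⟫) (s • e)
      simp only [add_sub_cancel_right] at h1
      exact h1
    show ∫ x, ⟪w (x + s • e) - w x, φ x⟫ = 0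
    simp_rw [inner_sub_left]
    rw [integral_sub i1 i2, hshift, integral_inner_comp_sub_smul_eq hw hM h hφ hdivφ s, sub_self]
  -- hence `g` is a.e. a constant, which must vanish
  obtain ⟨κ, hκ⟩ :=
    IsWeaklyDivFree.exists_ae_eq_const_of_norm_le_of_forall_integral_inner_eq_zero hgm hgb
      hgdiv horth
  have hκ0 : κ = 0 := eq_zero_of_ae_comp_add_sub_eq_const_of_norm_le hM hκ
  rw [hκ0] at hκ
  filter_upwards [hκ] with x hx
  exact sub_eq_zero.1 hx

end Invariance

end Literature.Analysis.FluidPDE
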